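import Literature.NumberTheory.CubicFields.DeloneFaddeevEquivariance
import Literature.NumberTheory.CubicFields.DeloneFaddeevSurjective
import Literature.NumberTheory.CubicFields.DeloneFaddeevIndexForm
import HarnessLib

/-!
# The Levi–Delone–Faddeev correspondence: `GL₂(ℤ)`-orbits of binary cubic forms ↔ cubic rings

Topic `Literature/NumberTheory/CubicFields`; the assembly of
`DeloneFaddeevRing.lean` (`R(f)`, `Disc R(f) = Disc f`), `DeloneFaddeevEquivariance.lean`
(`f ~ g ⇒ R(g) ≅ R(f)`), `DeloneFaddeevSurjective.lean` (every cubic ring is some `R(f)`) and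
`DeloneFaddeevIndexForm.lean` (`R(f) ≅ R(g) ⇒ f ~ g`; the index form of a basis).

Bhargava–Taniguchi–Thorne 2023, Theorem 2.1 ([Levi], [Delone–Faddeev], [Gan–Gross–Savin]):
"There is a canonical, discriminant-preserving bijection between the set of `GL₂(ℤ)`-orbits on
`V(ℤ)` and the set of isomorphism classes of cubic rings." Here, with BTT's definitions (§2.1: a
cubic ring is a commutative ring free of rank `3` over `ℤ`, its discriminant is that of the trace
form; §2.2 (8): the twisted action `(γ · f)(u,v) = det(γ)⁻¹ f((u,v)γ)`), this is the conjunction of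

* `RingOfForm.nonempty_ringEquiv_iff` — **`R(f) ≅ R(g)` iff `f` and `g` are `GL₂(ℤ)`-equivalent**
  (the map orbit ↦ isomorphism class is well defined and injective);
* `RingOfForm.exists_ringEquiv_of_finrank_eq_three` (in `DeloneFaddeevSurjective.lean`) and
  `nonempty_ringEquiv_indexForm` — **every cubic ring `R` is `≅ R(f)`**, namely for `f` the index
  form of any basis `(1, ω, θ)` of `R` (surjectivity, with the explicit inverse);
* `discr_eq_disc_indexForm` — **`Disc R = Disc f`** for `f` the index form of any basis through `1`
  (discriminant-preserving), and `RingOfForm.discr_basis_eq_disc` (`Disc R(f) = Disc f`).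

NOT here (the remaining clauses of Thm 2.1 and Prop 2.2): irreducible forms ↔ orders in cubic
fields, `Stab_{GL₂(ℤ)}(f) ≅ Aut(R)`, and the Davenport–Heilbronn maximality sets `U_p`.

## References

* M. Bhargava, T. Taniguchi, F. Thorne, *Improved error estimates for the Davenport–Heilbronn
  theorems*, Math. Ann. 389 (2024) = arXiv:2107.12819, Thm 2.1 [BhargavaTaniguchiThorne2023].
* B. N. Delone, D. K. Faddeev, *The theory of irrationalities of the third degree*, Transl. Math.
  Monographs 10, AMS (1964), §15.
* W. T. Gan, B. Gross, G. Savin, *Fourier coefficients of modular forms on `G₂`*, Duke Math. J.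
  115 (2002), §4, Prop. 4.2 [GanGrossSavin2002].
* M. Bhargava, A. Shankar, J. Tsimerman, *On the Davenport–Heilbronn theorems and second order
  terms*, Invent. Math. 193 (2013), §2 [BhargavaShankarTsimerman2012].
-/

namespace Literature.NumberTheory.CubicFields

open Module BinaryCubic

/-- **Levi–Delone–Faddeev, orbits ↔ isomorphism classes** (BTT 2023, Thm 2.1): the cubic rings of
two integral binary cubic forms are isomorphic if and only if the forms are `GL₂(ℤ)`-equivalent
for the twisted action `(γ · f)(u,v) = det(γ)⁻¹ f((u,v)γ)`. [cite: BhargavaTaniguchiThorne2023, Theorem 2.1 (bijection between GL₂(ℤ)-orbits on V(ℤ) and isomorphism classes of cubic rings)] -/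
theorem RingOfForm.nonempty_ringEquiv_iff (f g : BinaryCubic ℤ) :
    Nonempty (RingOfForm f ≃+* RingOfForm g) ↔ GL2ZEquiv f g :=
  ⟨fun ⟨φ⟩ => GL2ZEquiv.of_ringEquiv φ, fun h => RingOfForm.nonempty_ringEquiv_of_gl2zEquiv h.symm⟩

/-- The orbit of `f` is the set of forms whose ring is isomorphic to `R(f)`. [folklore] -/
theorem gl2zOrbit_eq_setOf_nonempty_ringEquiv (f : BinaryCubic ℤ) :
    gl2zOrbit f = {g | Nonempty (RingOfForm f ≃+* RingOfForm g)} := by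
  ext g
  exact (RingOfForm.nonempty_ringEquiv_iff f g).symm

section IndexForm

variable {R : Type*} [CommRing R]

/-- **The index form inverts `f ↦ R(f)`**: a commutative ring `R` with a `ℤ`-basis `b = (1, ω, θ)`
is isomorphic to the ring of the index form of `b`, by `x + yω + zθ ↦ x + y(b₁ − c₁₂₂) + z(b₂ − c₁₂₁)`
(BTT 2023, Thm 2.1, surjectivity with the explicit inverse; Gan–Gross–Savin Prop. 4.2; this is
`RingOfForm.exists_ringEquiv_of_basis_explicit` read through `indexForm`). [cite: BhargavaTaniguchiThorne2023, Theorem 2.1 (cubic ring ↦ GL₂(ℤ)-orbit, inverse map)] -/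
theorem exists_ringEquiv_indexForm (b : Basis (Fin 3) ℤ R) (hb : b 0 = 1) :
    ∃ e : RingOfForm (indexForm b) ≃+* R, ∀ P, e P = (P.x : R)
      + (P.y : R) * (b 1 - (b.repr (b 1 * b 2) 2 : R)) + (P.z : R) * (b 2 - (b.repr (b 1 * b 2) 1 : R)) :=
  RingOfForm.exists_ringEquiv_of_basis_explicit b hb

/-- In particular `R ≅ R(indexForm b)` for every basis `b` through `1`. [folklore] -/
theorem nonempty_ringEquiv_indexForm (b : Basis (Fin 3) ℤ R) (hb : b 0 = 1) :
    Nonempty (RingOfForm (indexForm b) ≃+* R) := by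
  obtain ⟨e, -⟩ := exists_ringEquiv_indexForm b hb
  exact ⟨e⟩

/-- The index forms of all bases through `1` of a cubic ring form one `GL₂(ℤ)`-orbit, and it is
the orbit attached to the ring: `R(g) ≅ R` iff `g ~ indexForm b`. [folklore] -/
theorem nonempty_ringEquiv_iff_gl2zEquiv_indexForm (b : Basis (Fin 3) ℤ R) (hb : b 0 = 1)
    (g : BinaryCubic ℤ) : Nonempty (RingOfForm g ≃+* R) ↔ GL2ZEquiv g (indexForm b) := by
  obtain ⟨e⟩ := nonempty_ringEquiv_indexForm b hb
  rw [← RingOfForm.nonempty_ringEquiv_iff]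
  exact ⟨fun ⟨φ⟩ => ⟨φ.trans e.symm⟩, fun ⟨φ⟩ => ⟨φ.trans e⟩⟩

/-- **Discriminant-preserving** (BTT 2023, Thm 2.1 with the definition of §2.1): the discriminant
of a cubic ring — the determinant of the trace form `Tr(xy)` on any `ℤ`-basis (Mathlib's
`Algebra.discr ℤ b`, independent of the basis) — equals `Disc` of the index form of any basis
through `1`. [cite: BhargavaTaniguchiThorne2023, Theorem 2.1 (discriminant-preserving)] -/
theorem discr_eq_disc_indexForm (b : Basis (Fin 3) ℤ R) (hb : b 0 = 1) :
    Algebra.discr ℤ b = (indexForm b).disc := by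
  classical
  obtain ⟨e⟩ := nonempty_ringEquiv_indexForm b hb
  -- compare with the transported basis `e(1, ω, θ)`, whose discriminant is that of `R(indexForm b)`
  let b₂ : Basis (Fin 3) ℤ R := (RingOfForm.basis (indexForm b)).map e.toAddEquiv.toIntLinearEquiv
  rw [Algebra.discr_eq_discr (b := b) (b' := b₂)]
  let e' : RingOfForm (indexForm b) ≃ₐ[ℤ] R := AlgEquiv.ofRingEquiv (f := e) fun n => by simp
  have hb₂ : (b₂ : Fin 3 → R) = e' ∘ RingOfForm.basis (indexForm b) := by
    ext i
    simp [b₂, e']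
  rw [hb₂, ← Algebra.discr_eq_discr_of_algEquiv, RingOfForm.discr_basis_eq_disc]

/-- In particular the discriminant of a cubic ring with a basis through `1` is the common
discriminant of the forms in its orbit: `Disc R = Disc g` whenever `R(g) ≅ R`. [folklore] -/
theorem discr_eq_disc_of_ringEquiv (b : Basis (Fin 3) ℤ R) (hb : b 0 = 1) {g : BinaryCubic ℤ}
    (φ : RingOfForm g ≃+* R) : Algebra.discr ℤ b = g.disc := by
  rw [discr_eq_disc_indexForm b hb,
    ((nonempty_ringEquiv_iff_gl2zEquiv_indexForm b hb g).mp ⟨φ⟩).disc_eq]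

end IndexForm

/-- **Every cubic ring is `R(f)` for a form `f` unique up to `GL₂(ℤ)`** (BTT 2023, Thm 2.1, the
bijection, for BTT's cubic rings = commutative rings free of rank `3` over `ℤ`): existence of `f`
with `R(f) ≅ R`, and any two such forms are `GL₂(ℤ)`-equivalent. [cite: BhargavaTaniguchiThorne2023, Theorem 2.1 (bijection, existence and uniqueness of the orbit)] -/
theorem existsUnique_gl2zOrbit_of_finrank_eq_three (R : Type*) [CommRing R] [Module.Free ℤ R]
    [Module.Finite ℤ R] (h3 : Module.finrank ℤ R = 3) :
    (∃ f : BinaryCubic ℤ, Nonempty (RingOfForm f ≃+* R)) ∧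
      ∀ f g : BinaryCubic ℤ, Nonempty (RingOfForm f ≃+* R) → Nonempty (RingOfForm g ≃+* R) →
        GL2ZEquiv f g := by
  refine ⟨RingOfForm.exists_ringEquiv_of_finrank_eq_three h3, fun f g ⟨φ⟩ ⟨ψ⟩ => ?_⟩
  exact GL2ZEquiv.of_ringEquiv (φ.trans ψ.symm)

end Literature.NumberTheory.CubicFields
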